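import Summits.ResolutionOfSingularities.ResolutionOfSingularities.Theorems.FrobeniusClosingPatchingRelPerfectDepthPhaseCStepStalk
import Summits.ResolutionOfSingularities.ResolutionOfSingularities.Theorems.FrobeniusClosingPatchingRelPerfectDepthMultiHostCyl
import Literature.AlgebraicGeometry.Resolution.MaximalContactPersistence
import Literature.AlgebraicGeometry.Resolution.BlowupDisjointCentreWeights
import HarnessLib

/-!
# Crux `PatchingRelPerfect` (stmt-ResolutionOfSingularities-16161), chain W5.2 — F7(β) (β-AX) X3 C-I pole chart PC-3 (+ PC-0):
# the EXPONENT BOOKKEEPING AT THE POLE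

[OURS · L1 W5.2 · res-L1-w52-plan-1 NAMING G12-18 (res-L1-w52-lead-1 POLE-CHART-PLAN 9677f7db11a8df4d, items PC-3 / PC-0), hand
res-L1-w52-stub-2 g6] After ONE generic step `S′ = S.step τ W η m ν` (new member `F = τ⁻¹W`, `e_i = m i + weightAt (exps i) η − ν`,
`μ_F = ⨅ᵢ e_i`) the residual stalk at a point `x′` is `K♭′_{x′} = ⨆ᵢ T_i(x′)` with the SUMMAND TERM
`T_i(x′) = (τᶜ(host i, m i))_{x′} · ∏_{(T,r) ∈ residualExps i} (T′)_{x′}^r · F_{x′}^{e_i − μ_F}` ((n1) `stalkIdeal_step_residual_K`,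
p561976).  THIS FILE: the `CylReach`-ready consequences, def-free, K-level / exponent-level, no charts.

* PC-3a: `stepExp_min_le`, `exists_stepExp_eq_min` — F-BARE summands (`e_i = μ_F`) exist; `mem_step_residualExps_new/_old` — the
  entries of `residualExps′ i`; `stepTerm_le_residual_stalk` — `T_i(x′) ≤ K♭′_{x′}`.
* PC-3b: `one_le_stepExp_sub_of_ne` (a non-bare summand has gap `≥ 1`), `stepTerm_le_stalk_F_of_ne` (non-bare ⇒ `T_i ≤ F_{x′}`:
  the F-HIT), `residual_stalk_le_F_of_bare` (`K♭′_{x′} ≤ F_{x′}` as soon as the bare summands are), `pow_F_le_residual_stalk_of_unit`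
  (a summand with unit host and no old member through `x′` puts `F_{x′}^{e_i − μ_F}` into `K♭′_{x′}` — gap `1` = «`F` is a carrier
  candidate»), `residual_stalk_eq_top_of_bare_unit` (a BARE such summand VACATES `x′`).
* PC-3c: `stepTerm_of_bare` (bare ⇒ no F-factor), `stepTerm_of_not_mem_F` (off `F` no F-factor), `stepTerm_eq_host_of_forall_not_mem`
  (no member through `x′` ⇒ the term is the host stalk).
* PC-0: `support_step_host_subset` (`Supp (host′ i) ⊆ τ⁻¹ Supp (host i)`), its stalk form `stalkIdeal_step_host_eq_top_of_not_mem`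
  (the `hhost` input read downstairs) and its carrier reading `mem_support_tr_of_mem_support_step_host` (over `x = j z`, a host
  with `z ∉ Supp (tr i)` misses every point of `τ⁻¹ x`; `CylState.comap_host_j`).

Fact-free; nothing here is a statement of the manuscript under review (AI-written; AI review weaker than expert review).

## References

* J. Kollár, *Lectures on Resolution of Singularities* (2007), (3.111) Steps 1–3. [Kollar2007]
* E. Bierstone, D. Grigoriev, P. Milman, J. Włodarczyk, arXiv:1206.3090, Def. 3.1.3, §4 Step 2b. [BierstoneGrigorievMilmanWlodarczyk2011]
-/

-- `Summit.<Summit>.<Sub>.Theorems` with `Sub = Summit` (single-conjunct summit, D-0017)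
set_option linter.dupNamespace false

noncomputable section

open CategoryTheory AlgebraicGeometry TopologicalSpace
open Literature.AlgebraicGeometry.Resolution
open Scheme.IdealSheafData

namespace Summit.ResolutionOfSingularities.ResolutionOfSingularities.Theorems.DepthMultiHost.MultiHostState

universe u

variable {X X' : Scheme.{u}} (S : MultiHostState X) [IsLocallyNoetherian X] (τ : X' ⟶ X) (W : Closeds X) (η : X)
  (m : Fin S.n → ℕ) (ν : ℕ) (hsnc : HasSNCWith S.𝓔 (vanishingIdeal W)) (hτ : IsBlowup τ (vanishingIdeal W))

/-- The new exponent `e_i = m i + weightAt (exps i) η − ν` of summand `i`. -/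
local notation3 "ee" => (fun i : Fin S.n => m i + weightAt (S.exps i) η - ν)
/-- The new member `F = τ⁻¹ W`. -/
local notation3 "FF" => ((vanishingIdeal W).comap τ)
/-- The summand term `T_i(x′)` of the successor's residual stalk. -/
local notation3 "Term[" i "," y "]" =>
  (stalkIdeal (controlledTransform τ (vanishingIdeal W) (S.host i) (m i)) y *
    ((((S.residualExps i).map fun p => stalkIdeal (strictTransformIdeal τ (vanishingIdeal W) p.1) y ^ p.2).prod) *
      stalkIdeal ((vanishingIdeal W).comap τ) y ^
        ((m i + weightAt (S.exps i) η - ν) - ⨅ i : Fin S.n, (m i + weightAt (S.exps i) η - ν))))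

/-! ## PC-3a: the new exponents and the bare summands -/

omit [IsLocallyNoetherian X] in
/-- `μ_F ≤ e_i`. [folklore] -/
theorem stepExp_min_le (i : Fin S.n) : (⨅ j : Fin S.n, ee j) ≤ ee i :=
  ciInf_le (OrderBot.bddBelow _) i

omit [IsLocallyNoetherian X] in
/-- **F-bare summands exist**: some summand attains `μ_F = ⨅ᵢ e_i` (there is a summand). [folklore] -/
theorem exists_stepExp_eq_min (hn : S.n ≠ 0) : ∃ i : Fin S.n, ee i = ⨅ j : Fin S.n, ee j := by
  haveI : Nonempty (Fin S.n) := ⟨⟨0, Nat.pos_of_ne_zero hn⟩⟩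
  exact exists_eq_ciInf_of_finite

/-- **The new member's entry** `(F, e_i − μ_F)` of `residualExps′ i`. [cite: Kollar2007, (3.111) Step 3] -/
theorem mem_step_residualExps_new (i : Fin S.n) :
    (FF, ee i - ⨅ j : Fin S.n, ee j) ∈ (S.step τ W η m ν hsnc hτ).residualExps i := by
  rw [step_residualExps]
  exact List.mem_append_right _ (List.mem_singleton_self _)

/-- **The old entries** `(T′, r)` of `residualExps′ i`, `(T, r) ∈ residualExps i`. [cite: Kollar2007, (3.111) Step 3] -/
theorem mem_step_residualExps_old (i : Fin S.n) {p : X.IdealSheafData × ℕ} (hp : p ∈ S.residualExps i) :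
    (strictTransformIdeal τ (vanishingIdeal W) p.1, p.2) ∈ (S.step τ W η m ν hsnc hτ).residualExps i := by
  rw [step_residualExps]
  exact List.mem_append_left _ (List.mem_map.mpr ⟨p, hp, rfl⟩)

/-- **Each summand term lies in the residual stalk**: `T_i(x′) ≤ K♭′_{x′}`. [folklore] -/
theorem stepTerm_le_residual_stalk (x' : X') (i : Fin S.n) :
    Term[i, x'] ≤ stalkIdeal (S.step τ W η m ν hsnc hτ).residual.K x' := by
  rw [stalkIdeal_step_residual_K]
  exact le_iSup (fun i : Fin S.n => Term[i, x']) i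

/-! ## PC-3b: gaps, F-hits, carriers, vacated points -/

omit [IsLocallyNoetherian X] in
/-- **A non-bare summand has gap at least one.** [folklore] -/
theorem one_le_stepExp_sub_of_ne (i : Fin S.n) (h : ee i ≠ ⨅ j : Fin S.n, ee j) : 1 ≤ ee i - ⨅ j : Fin S.n, ee j := by
  have hle := S.stepExp_min_le η m ν i
  omega

omit [IsLocallyNoetherian X] in
/-- **The F-hit**: a NON-BARE summand's term lies in `F_{x′}`. [cite: Kollar2007, (3.111) Step 3] -/
theorem stepTerm_le_stalk_F_of_ne (x' : X') (i : Fin S.n) (h : ee i ≠ ⨅ j : Fin S.n, ee j) :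
    Term[i, x'] ≤ stalkIdeal FF x' := by
  refine Ideal.mul_le_left.trans (Ideal.mul_le_left.trans ?_)
  exact Ideal.pow_le_self (Nat.one_le_iff_ne_zero.mp (S.one_le_stepExp_sub_of_ne η m ν i h))

/-- **`K♭′_{x′} ≤ F_{x′}` as soon as every BARE summand's term is.** [folklore] -/
theorem residual_stalk_le_F_of_bare (x' : X')
    (hbare : ∀ i : Fin S.n, ee i = ⨅ j : Fin S.n, ee j → Term[i, x'] ≤ stalkIdeal FF x') :
    stalkIdeal (S.step τ W η m ν hsnc hτ).residual.K x' ≤ stalkIdeal FF x' := by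
  rw [stalkIdeal_step_residual_K]
  refine iSup_le fun i => ?_
  by_cases h : ee i = ⨅ j : Fin S.n, ee j
  · exact hbare i h
  · exact S.stepTerm_le_stalk_F_of_ne τ W η m ν x' i h

omit [IsLocallyNoetherian X] in
/-- The old-member part of a term is the unit ideal when no old member with a positive residual exponent passes through `x′`.
[folklore] -/
theorem oldPart_eq_one (x' : X') (i : Fin S.n)
    (hold : ∀ p ∈ S.residualExps i, p.2 ≠ 0 →
      x' ∉ ((strictTransformIdeal τ (vanishingIdeal W) p.1).support : Set X')) :
    ((S.residualExps i).map fun p => stalkIdeal (strictTransformIdeal τ (vanishingIdeal W) p.1) x' ^ p.2).prod = 1 := by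
  refine List.prod_eq_one fun J hJ => ?_
  obtain ⟨p, hp, rfl⟩ := List.mem_map.mp hJ
  by_cases h0 : p.2 = 0
  · rw [h0, pow_zero]
  · rw [stalkIdeal_eq_top_of_not_mem_support (hold p hp h0), Ideal.top_pow, Ideal.one_eq_top]

/-- **Carrier candidate `F`**: a summand with UNIT host stalk at `x′` and no old member through `x′` puts `F_{x′}^{e_i − μ_F}` into
`K♭′_{x′}` (gap `1`: `F_{x′} ≤ K♭′_{x′}`). [cite: Kollar2007, (3.111) Step 3] -/
theorem pow_F_le_residual_stalk_of_unit (x' : X') (i : Fin S.n)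
    (hhost : stalkIdeal (controlledTransform τ (vanishingIdeal W) (S.host i) (m i)) x' = ⊤)
    (hold : ∀ p ∈ S.residualExps i, p.2 ≠ 0 →
      x' ∉ ((strictTransformIdeal τ (vanishingIdeal W) p.1).support : Set X')) :
    stalkIdeal FF x' ^ (ee i - ⨅ j : Fin S.n, ee j) ≤ stalkIdeal (S.step τ W η m ν hsnc hτ).residual.K x' := by
  have h := S.stepTerm_le_residual_stalk τ W η m ν hsnc hτ x' i
  rwa [hhost, S.oldPart_eq_one τ W x' i hold, Ideal.top_mul, one_mul] at h

/-- **A BARE summand with unit host stalk and no old member through `x′` VACATES `x′`**: `K♭′_{x′} = ⊤`. [folklore] -/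
theorem residual_stalk_eq_top_of_bare_unit (x' : X') (i : Fin S.n) (hbare : ee i = ⨅ j : Fin S.n, ee j)
    (hhost : stalkIdeal (controlledTransform τ (vanishingIdeal W) (S.host i) (m i)) x' = ⊤)
    (hold : ∀ p ∈ S.residualExps i, p.2 ≠ 0 →
      x' ∉ ((strictTransformIdeal τ (vanishingIdeal W) p.1).support : Set X')) :
    stalkIdeal (S.step τ W η m ν hsnc hτ).residual.K x' = ⊤ := by
  have h := S.pow_F_le_residual_stalk_of_unit τ W η m ν hsnc hτ x' i hhost hold
  have h0 : ee i - ⨅ j : Fin S.n, ee j = 0 := by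
    have := hbare; simp only at this; omega
  rw [h0, pow_zero, Ideal.one_eq_top] at h
  exact top_le_iff.mp h

/-! ## PC-3c: when the new member does not divide a term -/

omit [IsLocallyNoetherian X] in
/-- **Bare ⇒ no F-factor.** [folklore] -/
theorem stepTerm_of_bare (x' : X') (i : Fin S.n) (hbare : ee i = ⨅ j : Fin S.n, ee j) :
    Term[i, x'] = stalkIdeal (controlledTransform τ (vanishingIdeal W) (S.host i) (m i)) x' *
      ((S.residualExps i).map fun p => stalkIdeal (strictTransformIdeal τ (vanishingIdeal W) p.1) x' ^ p.2).prod := by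
  have h0 : ee i - ⨅ j : Fin S.n, ee j = 0 := by
    have := hbare; simp only at this; omega
  rw [h0, pow_zero, mul_one]

omit [IsLocallyNoetherian X] in
/-- **Off `F` there is no F-factor.** [folklore] -/
theorem stepTerm_of_not_mem_F (x' : X') (i : Fin S.n) (hx' : x' ∉ ((FF).support : Set X')) :
    Term[i, x'] = stalkIdeal (controlledTransform τ (vanishingIdeal W) (S.host i) (m i)) x' *
      ((S.residualExps i).map fun p => stalkIdeal (strictTransformIdeal τ (vanishingIdeal W) p.1) x' ^ p.2).prod := by
  rw [stalkIdeal_eq_top_of_not_mem_support hx', Ideal.top_pow, Ideal.mul_top]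

omit [IsLocallyNoetherian X] in
/-- **No member through `x′` ⇒ the term is the host stalk** (off `F`, off every old member with a positive residual exponent).
[folklore] -/
theorem stepTerm_eq_host_of_forall_not_mem (x' : X') (i : Fin S.n) (hx' : x' ∉ ((FF).support : Set X'))
    (hold : ∀ p ∈ S.residualExps i, p.2 ≠ 0 →
      x' ∉ ((strictTransformIdeal τ (vanishingIdeal W) p.1).support : Set X')) :
    Term[i, x'] = stalkIdeal (controlledTransform τ (vanishingIdeal W) (S.host i) (m i)) x' := by
  rw [S.stepTerm_of_not_mem_F τ W η m ν x' i hx', S.oldPart_eq_one τ W x' i hold, mul_one]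

/-! ## PC-0: a host absent downstairs is absent upstairs -/

/-- **`Supp (host′ i) ⊆ τ⁻¹ Supp (host i)`**: the controlled transform contains the total transform. [folklore] -/
theorem support_step_host_subset (i : Fin S.n) :
    (((S.step τ W η m ν hsnc hτ).host i).support : Set X') ⊆ τ.base ⁻¹' (S.host i).support := by
  rw [step_host]
  exact support_controlledTransform_subset_preimage (π := τ) (C := vanishingIdeal W) (S.host i) (m i)

omit [IsLocallyNoetherian X] in
/-- **PC-0, stalk form**: a host which is a unit at `τ x′` has a unit controlled transform at `x′` — the `hhost` input of
`pow_F_le_residual_stalk_of_unit` / `residual_stalk_eq_top_of_bare_unit` read downstairs. [folklore] -/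
theorem stalkIdeal_step_host_eq_top_of_not_mem (i : Fin S.n) {x' : X'} (hx : τ.base x' ∉ ((S.host i).support : Set X)) :
    stalkIdeal (controlledTransform τ (vanishingIdeal W) (S.host i) (m i)) x' = ⊤ :=
  stalkIdeal_eq_top_of_not_mem_support fun h =>
    hx (support_controlledTransform_subset_preimage (π := τ) (C := vanishingIdeal W) (S.host i) (m i) h)

/-- **PC-0, carrier reading**: over `x = j z`, a host whose trace misses `z` misses every point of `τ⁻¹ x`. [folklore] -/
theorem mem_support_tr_of_mem_support_step_host (cyl : CylState S) (i : Fin S.n) {x' : X'} {z : cyl.Z}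
    (hx : τ.base x' = cyl.j.base z) (h : x' ∈ (((S.step τ W η m ν hsnc hτ).host i).support : Set X')) :
    z ∈ ((cyl.tr i).support : Set cyl.Z) := by
  have h1 : τ.base x' ∈ ((S.host i).support : Set X) := S.support_step_host_subset τ W η m ν hsnc hτ i h
  rw [hx] at h1
  rw [← cyl.comap_host_j i]
  exact (mem_support_comap_iff cyl.j (S.host i) z).mpr h1

end Summit.ResolutionOfSingularities.ResolutionOfSingularities.Theorems.DepthMultiHost.MultiHostState

end
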